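import Mathlib
import HarnessLib
import Summits.QuantumFields.YangMills.Theses.ScalingWindowSplit
import Summits.QuantumFields.YangMills.Theorems.ScalingWindowSplitExistenceLegFromLatticeR
import Summits.QuantumFields.YangMills.Theorems.SelfNormalisedMomentBounds.Negative.SelfNormalisedMomentBoundsFalseOfTwoRateWindowScheme

/-!
# `SelfNormalisedMomentBoundsR` (stmt-QuantumFields-18014) — negative lemma: the TWO-POINT ENVELOPE, and
# U_R is false modulo ONE admissible two-rate pair

Crux disprover (`cdisprove-stmt-QuantumFields-18014-g2`) on crux U_R = `ScalingWindowSplit.SelfNormalisedMomentBoundsR`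
of route `ScalingWindowSplit` (rev 8).

**Finding (kernel-checked here).**  U_R is typed for ALL compact `G` ("group-blind").  Already its `n ≤ 2` content
forces a UNIFORM TWO-POINT ENVELOPE of the bare plaquette field along every admissible datum
(`twoPointEnvelope_of_selfNormalisedMomentBoundsR`): there are ONE Schwartz order `s` and ONE constant `B` such that,
eventually in `k`, for EVERY pair of real tests `v, w` with disjoint supports,
`|T⁰_k(v, w)| ≤ B · (|v|ₛ + 1) · (|w|ₛ + 1) · T⁰_k(u, θu)` — the reference reflected pair `(u, θu)` is, up to Schwartz
norms, the LARGEST bare covariance scale of the whole theory, at every `k`.  (The crux strategist's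
`rate_rigidity_of_selfNormalisedMomentBoundsR`, crux workfile `MaskedSectorObstruction.lean`, is the pointwise-in-`(v, θv)`
case; here the pair is arbitrary and the constant is uniform.)  Consequently (`SelfNormalisedMomentBoundsR_false_of_TwoRatePairScheme`)
U_R is false as soon as ONE admissible datum carries ONE disjoint pair `(v, w)` whose bare covariance is infinitely often
larger than any multiple of the reference one (`TwoRatePairScheme`, the hypothesis `H` of this negative lemma), and
(`SelfNormalisedMomentBoundsR_false_of_envelopeFailure`) as soon as the envelope fails along `k`-DEPENDENT normalised pairs
for every order `s` (the literal negation of the `n = 2` content; stated inline, no second hypothesis is named).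

**Why `H` is expected, and why it is not constructible here (class on paper: misstated — missing simplicity of `G`).**
The MASKED PRODUCT GROUP (crux strategist, census §1; crux idea `masked-abelian-sector`): `G = U(1) × SU(2)`,
`r = e^{iθ} ⊕ V` (faithful; Wilson's measure factorises and the action density is the SUM of two independent sectors, so
`T⁰ = T⁰_{U(1)} + T⁰_{SU(2)}`).  Along `β_k ↑ ∞` put the non-abelian confinement scale at a SHORT physical length
`ε_k = a_k ξ_{SU(2)}(β_k) = 1/(2 log β_k) → 0`: the abelian Coulomb sector carries floor and window at an honest
past-supported bump `u` (massless photon pair, `T⁰_{U(1)} ≍ a_k⁸ β_k⁻²`), the `SU(2)` sector is exponentially small at the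
`u`-scale (`e^{-2d/ε_k} = β_k^{-4d}`, `d > 1/2`), but a pair `(v, w)` at mutual physical distance `≈ ε`-independent
`d₀ < 1/2` (or, for the inline envelope form, bumps of radius `ε_k`) sees the `SU(2)` plaquette two-point function AT ITS
OWN CONFINEMENT SCALE, `≍ ξ^{-8}` with a `β`-INDEPENDENT constant (running coupling `O(1)` there: asymptotic freedom /
dimensional transmutation), i.e. `β_k²` times the abelian `β_k⁻² d^{-8}` law that normalises `canon`:
`|T⁰_k(v,w)| / T⁰_k(u,θu) ≍ β_k^{2-4d₀} (log β_k)⁸ → ∞`.  Inhabiting `H` rigorously needs (P1) Coulomb-phase control of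
Wilson-`U(1)₄` plaquette correlations (Guth 1980, Fröhlich–Spencer 1982) AND (P2) scaling + mass gap + two-sided control of
`SU(2)₄` plaquette correlations at the confinement scale — the lattice form of the Clay problem for `SU(2)`; not
constructible in the tree.  Every OTHER sector type is harmless: abelian factors are Gaussian with the same `d^{-8}` shape
at every scale (no second rate), finite factors freeze (`e^{-cβ}` at the lattice scale, BELOW the abelian `β⁻²`), and a
simple factor read in its perturbative window is SOFTER than `d^{-8}` at short distance (the coupling decreases towards the
ultraviolet) — the enhancement needs a non-abelian factor AT confinement placed below the reference scale, nothing less.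

**Repair (the minimal `C′`, already certified glue-compatible by the strategist as `SelfNormalisedMomentBoundsRS` with
`existenceLegFromLatticeRS` / `closesRS`, and by the lead's transfer file `SelfNormalisedMomentBoundsRS.lean`):** insert
`IsCompactSimpleLieGroup G →` after the instance binders of U_R.  The Statement `YangMills`, W₁ `GapAtCorrelationLength` and
the consumer `HypercubicLimit` all carry it, so the route's `closes` re-points with one more token; the masked witness
(a product, not simple) misses `C′`; all eight landed stubs of line `Sketch` are `G`-generic and transfer verbatim, only the
physics stub `stub_clusterBound` acquires the simplicity hypothesis (as `stub_clusterBoundS`).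

Contents: `twoPointEnvelope_of_uniformMomentBoundsPlanes` (moment bounds of `canon` + `T⁰ > 0` ⇒ uniform `n = 2`
envelope; reusable by hypothesis-dropped variants), `twoPointEnvelope_of_selfNormalisedMomentBoundsR` (U_R ⇒ envelope),
`TwoRatePairScheme` (`H`), `SelfNormalisedMomentBoundsR_false_of_TwoRatePairScheme` (`H → ¬U_R`),
`SelfNormalisedMomentBoundsR_false_of_envelopeFailure` (inline `k`-dependent form).  No positive instance of a Theses
decl is asserted.  No `sorry`; axioms `propext`, `Classical.choice`, `Quot.sound`.
-/

noncomputable section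

open scoped SchwartzMap BigOperators Topology
open MeasureTheory ProbabilityTheory Filter Topology
open Literature.MathematicalPhysics.AQFT Literature.MathematicalPhysics.QuantumLattice
open Literature.MathematicalPhysics.QuantumFieldTheory
open Summit.QuantumFields.YangMills.Cruxes.HypercubicLimit.CouplingResponse
open Summit.QuantumFields.YangMills.Theorems.ScalingWindowSplit (trunc_rescale trunc_eq_covariance)
open Summit.QuantumFields.YangMills.Theorems.SelfNormalisedMomentBounds.Negative (trunc_smul)

namespace Summit.QuantumFields.YangMills.Theorems.SelfNormalisedMomentBoundsR.Negative

variable {G : Type} [Group G] [TopologicalSpace G] [IsTopologicalGroup G] [CompactSpace G]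
  [MeasurableSpace G] [BorelSpace G]

/-- **Moment bounds of the self-normalised scheme force a UNIFORM two-point envelope** (the `n ≤ 2` content, factored
through the conclusion so that hypothesis-dropped variants of U_R can reuse it).  For ANY scheme `sch` and bump `u`: if the
self-normalised scheme `canon` (`c'_k = 1/√T⁰_k(u,θu)`, torus-mean counterterm) obeys `UniformMomentBoundsPlanes r canon` and
`T⁰_k(u,θu) > 0` eventually, then there are ONE Schwartz order `s` and ONE constant `B ≥ 0` such that eventually in `k`, for
EVERY pair of real tests `v, w` with disjoint supports, `|T⁰_k(v, w)| ≤ B (|v|ₛ + 1)(|w|ₛ + 1) · T⁰_k(u, θu)`.  Proof: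
`c'_k² = 1/T⁰_k(u,θu)` on the tail; the bounds at orders `1` and `2` (through the landed `uniformMomentBounds_of_planes`)
control `|𝔖₂^canon(λv ⊗ λ'w)|`, `|𝔖₁^canon(λv)|`, `|𝔖₁^canon(λ'w)|` uniformly in `k` and in the normalised pair, and the seam
identity (`trunc_rescale`, `trunc_smul`) reads `𝔖₂^canon − 𝔖₁^canon 𝔖₁^canon = λλ' T⁰_k(v,w) / T⁰_k(u,θu)` with
`λ = (|v|ₛ+1)⁻¹`, `λ' = (|w|ₛ+1)⁻¹`. [folklore] -/
theorem twoPointEnvelope_of_uniformMomentBoundsPlanes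
    (r : LatticeRep G) (sch : SpeciesScheme (YMSpecies G)) (u : 𝓢(EuclideanSpace ℝ (Fin 4), ℝ)) :
    let bare : SpeciesScheme (YMSpecies G) := { sch with c := fun _ _ => 1, m := fun _ _ => 0 }
    let T : 𝓢(EuclideanSpace ℝ (Fin 4), ℝ) → ℕ → ℝ := fun w k =>
      latticeSchwinger r.ρ bare (fun s => s.F) k (1 + 1) (fun _ => r.curvature) ![w, thetaTest 4 w] -
        latticeSchwinger r.ρ bare (fun s => s.F) k 1 (fun _ => r.curvature) ![w] *
          latticeSchwinger r.ρ bare (fun s => s.F) k 1 (fun _ => r.curvature) ![thetaTest 4 w]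
    let T₂ : 𝓢(EuclideanSpace ℝ (Fin 4), ℝ) → 𝓢(EuclideanSpace ℝ (Fin 4), ℝ) → ℕ → ℝ := fun v w k =>
      latticeSchwinger r.ρ bare (fun s => s.F) k (1 + 1) (fun _ => r.curvature) ![v, w] -
        latticeSchwinger r.ρ bare (fun s => s.F) k 1 (fun _ => r.curvature) ![v] *
          latticeSchwinger r.ρ bare (fun s => s.F) k 1 (fun _ => r.curvature) ![w]
    let canon : SpeciesScheme (YMSpecies G) :=
      { sch with
        c := fun _ k => (Real.sqrt (T u k))⁻¹
        m := fun _ k => ∫ U, r.curvature.F (torusLift (sch.side k) U) ∂(wilsonMeasure r.ρ (sch.β k)) }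
    UniformMomentBoundsPlanes r canon →
    (∀ᶠ k in Filter.atTop, 0 < T u k) →
    ∃ (s : ℕ) (B : ℝ), 0 ≤ B ∧ ∀ᶠ k in Filter.atTop, 0 < T u k ∧
      ∀ v w : 𝓢(EuclideanSpace ℝ (Fin 4), ℝ), Disjoint (tsupport v) (tsupport w) →
        |T₂ v w k| ≤ B * (schwartzNorm s (ofRealTest v) + 1) * (schwartzNorm s (ofRealTest w) + 1) * T u k := by
  intro bare T T₂ canon hP hT
  obtain ⟨s, C₀, C₁, hb⟩ := uniformMomentBounds_of_planes G r canon hP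
  -- the uniform constants
  set A₁ : ℝ := C₀ * C₁ ^ 1 * (Nat.factorial 1 : ℕ) with hA₁
  set A₂ : ℝ := C₀ * C₁ ^ (1 + 1) * (Nat.factorial (1 + 1) : ℕ) with hA₂
  set B₀ : ℝ := |A₂| + A₁ * A₁ with hB₀
  -- `A₁ ≥ 0`: U_R at order one on the zero test function
  have hA₁0 : 0 ≤ A₁ := by
    have h := hb 1 ![0] (by
        intro i; fin_cases i
        simp [schwartzNorm]) (by intro i j hij; exact absurd (Subsingleton.elim i j) hij) 0
    exact (abs_nonneg _).trans h
  have hB₀0 : 0 ≤ B₀ := add_nonneg (abs_nonneg _) (mul_nonneg hA₁0 hA₁0)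
  refine ⟨s, B₀, hB₀0, hT.mono fun k hTpos => ?_⟩
  refine ⟨hTpos, fun v w hdisj => ?_⟩
  -- the normalised pair
  set N₁ : ℝ := schwartzNorm s (ofRealTest v) with hN₁
  set N₂ : ℝ := schwartzNorm s (ofRealTest w) with hN₂
  have hN₁0 : 0 ≤ N₁ := schwartzNorm_nonneg _ _
  have hN₂0 : 0 ≤ N₂ := schwartzNorm_nonneg _ _
  set l₁ : ℝ := (N₁ + 1)⁻¹ with hl₁
  set l₂ : ℝ := (N₂ + 1)⁻¹ with hl₂
  have hl₁0 : 0 < l₁ := inv_pos.2 (by linarith)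
  have hl₂0 : 0 < l₂ := inv_pos.2 (by linarith)
  set v₁ : 𝓢(EuclideanSpace ℝ (Fin 4), ℝ) := l₁ • v with hv₁
  set w₁ : 𝓢(EuclideanSpace ℝ (Fin 4), ℝ) := l₂ • w with hw₁
  have hn₁ : schwartzNorm s (ofRealTest v₁) ≤ 1 := by
    rw [hv₁, schwartzNorm_ofRealTest_smul, abs_of_pos hl₁0, ← hN₁, hl₁]
    rw [inv_mul_le_iff₀ (by linarith : (0 : ℝ) < N₁ + 1)]
    linarith
  have hn₂ : schwartzNorm s (ofRealTest w₁) ≤ 1 := by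
    rw [hw₁, schwartzNorm_ofRealTest_smul, abs_of_pos hl₂0, ← hN₂, hl₂]
    rw [inv_mul_le_iff₀ (by linarith : (0 : ℝ) < N₂ + 1)]
    linarith
  have hd₁₂ : Disjoint (tsupport (v₁ : EuclideanSpace ℝ (Fin 4) → ℝ))
      (tsupport (w₁ : EuclideanSpace ℝ (Fin 4) → ℝ)) :=
    hdisj.mono (tsupport_smul_subset_right (fun _ => l₁) _) (tsupport_smul_subset_right (fun _ => l₂) _)
  -- U_R at orders two and one
  have h2 := hb (1 + 1) ![v₁, w₁]
    (by
      intro i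
      fin_cases i
      · simpa using hn₁
      · simpa using hn₂)
    (by
      intro i j hij
      fin_cases i <;> fin_cases j
      · exact absurd rfl hij
      · simpa using hd₁₂
      · simpa using hd₁₂.symm
      · exact absurd rfl hij) k
  have h1 := hb 1 ![v₁] (by intro i; fin_cases i; simpa using hn₁)
    (by intro i j hij; exact absurd (Subsingleton.elim i j) hij) k
  have h1' := hb 1 ![w₁] (by intro i; fin_cases i; simpa using hn₂)
    (by intro i j hij; exact absurd (Subsingleton.elim i j) hij) k
  -- the seam: `𝔖₂^canon − 𝔖₁^canon 𝔖₁^canon = c'_k² · l₁ l₂ · T⁰_k(v, w)`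
  have hseam :
      latticeSchwinger r.ρ canon (fun s => s.F) k (1 + 1) (fun _ => r.curvature) ![v₁, w₁] -
          latticeSchwinger r.ρ canon (fun s => s.F) k 1 (fun _ => r.curvature) ![v₁] *
            latticeSchwinger r.ρ canon (fun s => s.F) k 1 (fun _ => r.curvature) ![w₁] =
        canon.c r.curvature k ^ 2 * (l₁ * l₂ * T₂ v w k) := by
    rw [trunc_rescale r canon k v₁ w₁, hv₁, hw₁, trunc_smul]
  have hc : canon.c r.curvature k ^ 2 = (T u k)⁻¹ := by
    show ((Real.sqrt (T u k))⁻¹) ^ 2 = (T u k)⁻¹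
    rw [inv_pow, Real.sq_sqrt hTpos.le]
  have hA₁k : 0 ≤ |latticeSchwinger r.ρ canon (fun s => s.F) k 1 (fun _ => r.curvature) ![v₁]| := abs_nonneg _
  -- |𝔖₂ − 𝔖₁𝔖₁| ≤ A₂ + A₁²
  have hkey : |(T u k)⁻¹ * (l₁ * l₂ * T₂ v w k)| ≤ B₀ := by
    rw [← hc, ← hseam]
    refine (abs_sub _ _).trans (add_le_add (h2.trans (le_abs_self A₂)) ?_)
    rw [abs_mul]
    exact mul_le_mul (h1) (h1') (abs_nonneg _) hA₁0
  rw [abs_mul, abs_mul, abs_of_pos (inv_pos.2 hTpos), abs_of_pos (mul_pos hl₁0 hl₂0)] at hkey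
  -- unwind: |T₂ v w k| ≤ B₀ (N₁+1)(N₂+1) · T u k
  have hll : 0 < l₁ * l₂ := mul_pos hl₁0 hl₂0
  have hprod : (N₁ + 1) * (N₂ + 1) * (l₁ * l₂) = 1 := by
    rw [hl₁, hl₂]; field_simp
  have := mul_le_mul_of_nonneg_left hkey hTpos.le
  -- T u k * (T u k)⁻¹ * (l₁ l₂ |T₂|) = l₁ l₂ |T₂|
  have hstep : l₁ * l₂ * |T₂ v w k| ≤ T u k * B₀ := by
    calc l₁ * l₂ * |T₂ v w k| = T u k * ((T u k)⁻¹ * (l₁ * l₂ * |T₂ v w k|)) := by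
          field_simp
      _ ≤ T u k * B₀ := this
  calc |T₂ v w k| = ((N₁ + 1) * (N₂ + 1)) * (l₁ * l₂ * |T₂ v w k|) := by
        rw [← mul_assoc, hprod, one_mul]
    _ ≤ ((N₁ + 1) * (N₂ + 1)) * (T u k * B₀) :=
        mul_le_mul_of_nonneg_left hstep (mul_nonneg (by linarith) (by linarith))
    _ = B₀ * (N₁ + 1) * (N₂ + 1) * T u k := by ring

/-- **U_R forces a UNIFORM two-point envelope.**  If `SelfNormalisedMomentBoundsR` holds then at every admissible datum
`(G, r, sch, u, p, M)` of U_R (weak coupling, polynomial volumes, `u` supported at negative times, floor and window at `u`)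
there are ONE Schwartz order `s` and ONE constant `B ≥ 0` such that, for all large `k` and for EVERY pair of real tests
`v, w` with disjoint supports, `|T⁰_k(v, w)| ≤ B (|v|ₛ + 1)(|w|ₛ + 1) · T⁰_k(u, θu)`: the reference reflected pair is, up
to Schwartz norms, the largest bare covariance scale of the theory.  (U_R at the datum gives
`UniformMomentBoundsPlanes r canon` by `Iff.rfl`; the floor gives `T⁰_k(u,θu) ≥ a_k^p > 0`; then
`twoPointEnvelope_of_uniformMomentBoundsPlanes`.) [folklore] -/
theorem twoPointEnvelope_of_selfNormalisedMomentBoundsR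
    (hU : Summit.QuantumFields.YangMills.Theses.ScalingWindowSplit.SelfNormalisedMomentBoundsR)
    (r : LatticeRep G) (sch : SpeciesScheme (YMSpecies G))
    (u : 𝓢(EuclideanSpace ℝ (Fin 4), ℝ)) (p : ℕ) (M : ℝ) :
    let bare : SpeciesScheme (YMSpecies G) := { sch with c := fun _ _ => 1, m := fun _ _ => 0 }
    let T : 𝓢(EuclideanSpace ℝ (Fin 4), ℝ) → ℕ → ℝ := fun w k =>
      latticeSchwinger r.ρ bare (fun s => s.F) k (1 + 1) (fun _ => r.curvature) ![w, thetaTest 4 w] -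
        latticeSchwinger r.ρ bare (fun s => s.F) k 1 (fun _ => r.curvature) ![w] *
          latticeSchwinger r.ρ bare (fun s => s.F) k 1 (fun _ => r.curvature) ![thetaTest 4 w]
    let T₂ : 𝓢(EuclideanSpace ℝ (Fin 4), ℝ) → 𝓢(EuclideanSpace ℝ (Fin 4), ℝ) → ℕ → ℝ := fun v w k =>
      latticeSchwinger r.ρ bare (fun s => s.F) k (1 + 1) (fun _ => r.curvature) ![v, w] -
        latticeSchwinger r.ρ bare (fun s => s.F) k 1 (fun _ => r.curvature) ![v] *
          latticeSchwinger r.ρ bare (fun s => s.F) k 1 (fun _ => r.curvature) ![w]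
    sch.HasWeakCouplingLimit →
    (∃ N : ℕ, 1 ≤ N ∧ ∀ᶠ k in Filter.atTop, (sch.a k)⁻¹ ≤ (sch.a k * (sch.L k : ℝ)) ^ N) →
    tsupport u ⊆ {y : EuclideanSpace ℝ (Fin 4) | y 0 < 0} →
    (∀ᶠ k in Filter.atTop, (sch.a k) ^ p ≤ T u k ∧ T u k ≤ M * T (timeShiftTest 4 (-1) u) k) →
    ∃ (s : ℕ) (B : ℝ), 0 ≤ B ∧ ∀ᶠ k in Filter.atTop, 0 < T u k ∧
      ∀ v w : 𝓢(EuclideanSpace ℝ (Fin 4), ℝ), Disjoint (tsupport v) (tsupport w) →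
        |T₂ v w k| ≤ B * (schwartzNorm s (ofRealTest v) + 1) * (schwartzNorm s (ofRealTest w) + 1) * T u k := by
  intro bare T T₂ hw hpv hu hfw
  exact twoPointEnvelope_of_uniformMomentBoundsPlanes r sch u (hU G r sch u p M hw hpv hu hfw)
    (hfw.mono fun k hk => (pow_pos (sch.a_pos k) p).trans_le hk.1)

/-- **`H` — an admissible TWO-RATE PAIR** (hypothesis of the negative lemma; not constructible in the tree).
Some compact `G`, faithful `r`, Wilson scheme `sch`, bump `u` SUPPORTED AT NEGATIVE TIMES, `p`, `M` meet exactly the four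
hypothesis blocks of U_R (weak coupling, polynomial volumes, past support, polynomial floor and window at `u`), and some
pair of real tests `v, w` with disjoint supports has its bare truncated two-point function infinitely often larger than any
multiple of the reference one: `∀ B, ∃ᶠ k, B · T⁰_k(u,θu) < |T⁰_k(v,w)|`.  Intended inhabitant (physics-grade): the MASKED
PRODUCT GROUP `U(1) × SU(2)`, `r = e^{iθ} ⊕ V`, `a_k ξ_{SU(2)}(β_k) = 1/(2 log β_k)`, `u` a bump at time-distance `> 1/2`
from the hyperplane, `(v, w) = (v, θv)` with `v` a bump at time-distance `< 1/2` — conditionally on (P1) Coulomb control of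
Wilson-`U(1)₄` and (P2) scaling + gap + Ornstein–Zernike control of `SU(2)₄` at its confinement scale with `β`-independent
constants, the expected (open) Clay behaviour of `SU(2)`.  The crux strategist's `TwoRateHonestWindowScheme` (reflected
pairs `w = θv`) is the special case `w := thetaTest 4 v`.  A HYPOTHESIS (no citation tag on purpose). -/
def TwoRatePairScheme : Prop :=
  ∃ (G : Type) (_ : Group G) (_ : TopologicalSpace G) (_ : IsTopologicalGroup G) (_ : CompactSpace G)
    (_ : MeasurableSpace G) (_ : BorelSpace G) (r : LatticeRep G) (sch : SpeciesScheme (YMSpecies G))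
    (u v w : 𝓢(EuclideanSpace ℝ (Fin 4), ℝ)) (p : ℕ) (M : ℝ),
    let bare : SpeciesScheme (YMSpecies G) := { sch with c := fun _ _ => 1, m := fun _ _ => 0 }
    let T : 𝓢(EuclideanSpace ℝ (Fin 4), ℝ) → ℕ → ℝ := fun w k =>
      latticeSchwinger r.ρ bare (fun s => s.F) k (1 + 1) (fun _ => r.curvature) ![w, thetaTest 4 w] -
        latticeSchwinger r.ρ bare (fun s => s.F) k 1 (fun _ => r.curvature) ![w] *
          latticeSchwinger r.ρ bare (fun s => s.F) k 1 (fun _ => r.curvature) ![thetaTest 4 w]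
    let T₂ : 𝓢(EuclideanSpace ℝ (Fin 4), ℝ) → 𝓢(EuclideanSpace ℝ (Fin 4), ℝ) → ℕ → ℝ := fun v w k =>
      latticeSchwinger r.ρ bare (fun s => s.F) k (1 + 1) (fun _ => r.curvature) ![v, w] -
        latticeSchwinger r.ρ bare (fun s => s.F) k 1 (fun _ => r.curvature) ![v] *
          latticeSchwinger r.ρ bare (fun s => s.F) k 1 (fun _ => r.curvature) ![w]
    sch.HasWeakCouplingLimit ∧
    (∃ N : ℕ, 1 ≤ N ∧ ∀ᶠ k in Filter.atTop, (sch.a k)⁻¹ ≤ (sch.a k * (sch.L k : ℝ)) ^ N) ∧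
    tsupport u ⊆ {y : EuclideanSpace ℝ (Fin 4) | y 0 < 0} ∧
    (∀ᶠ k in Filter.atTop, (sch.a k) ^ p ≤ T u k ∧ T u k ≤ M * T (timeShiftTest 4 (-1) u) k) ∧
    Disjoint (tsupport v) (tsupport w) ∧
    ∀ B : ℝ, ∃ᶠ k in Filter.atTop, B * T u k < |T₂ v w k|

/-- **Negative lemma modulo `H`: one admissible two-rate pair refutes U_R as typed.**
`TwoRatePairScheme → ¬ SelfNormalisedMomentBoundsR`: at the datum of `H`, the two-point envelope
(`twoPointEnvelope_of_selfNormalisedMomentBoundsR`) gives `|T⁰_k(v,w)| ≤ B (|v|ₛ+1)(|w|ₛ+1) · T⁰_k(u,θu)` eventually,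
contradicting the second rate infinitely often.  Class (on paper): refuted-misstated — U_R quantifies over ALL compact `G`;
the masked product group `U(1) × SU(2)` is the expected inhabitant of `H`; the repaired statement inserts
`IsCompactSimpleLieGroup G →` (strategist's `SelfNormalisedMomentBoundsRS`, glue-compatible), which the Statement supplies and
which no product / abelian-factor group meets. [folklore] -/
theorem SelfNormalisedMomentBoundsR_false_of_TwoRatePairScheme :
    TwoRatePairScheme →
      ¬ Summit.QuantumFields.YangMills.Theses.ScalingWindowSplit.SelfNormalisedMomentBoundsR := by
  rintro ⟨G, _, _, _, _, _, _, r, sch, u, v, w, p, M, hw, hpv, hu, hfw, hdisj, hrate⟩ hU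
  obtain ⟨s, B, -, hB⟩ := twoPointEnvelope_of_selfNormalisedMomentBoundsR hU r sch u p M hw hpv hu hfw
  obtain ⟨k, hk₁, hk₂⟩ :=
    ((hrate (B * (schwartzNorm s (ofRealTest v) + 1) * (schwartzNorm s (ofRealTest w) + 1))).and_eventually hB).exists
  exact absurd hk₁ (not_lt.2 (hk₂.2 v w hdisj))

/-- **Negative lemma, inline `k`-dependent form: a failing two-point envelope refutes U_R as typed.**  If at some
admissible datum the envelope fails for EVERY Schwartz order — for all `s` and `B`, infinitely often in `k` there is a
`|·|ₛ`-normalised pair `(v, w)` with disjoint supports and `B · T⁰_k(u,θu) < |T⁰_k(v,w)|` (the pair may move with `k`: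
shrinking bumps at the collapsing confinement scale `ε_k` of a masked non-abelian sector are the intended instance) — then
`SelfNormalisedMomentBoundsR` is false.  This hypothesis is implied by `TwoRatePairScheme` (fix the pair) and is the literal
negation of the `n = 2` content of U_R at that datum; it is stated inline (no second named hypothesis). [folklore] -/
theorem SelfNormalisedMomentBoundsR_false_of_envelopeFailure :
    (∃ (G : Type) (_ : Group G) (_ : TopologicalSpace G) (_ : IsTopologicalGroup G) (_ : CompactSpace G)
      (_ : MeasurableSpace G) (_ : BorelSpace G) (r : LatticeRep G) (sch : SpeciesScheme (YMSpecies G))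
      (u : 𝓢(EuclideanSpace ℝ (Fin 4), ℝ)) (p : ℕ) (M : ℝ),
      let bare : SpeciesScheme (YMSpecies G) := { sch with c := fun _ _ => 1, m := fun _ _ => 0 }
      let T : 𝓢(EuclideanSpace ℝ (Fin 4), ℝ) → ℕ → ℝ := fun w k =>
        latticeSchwinger r.ρ bare (fun s => s.F) k (1 + 1) (fun _ => r.curvature) ![w, thetaTest 4 w] -
          latticeSchwinger r.ρ bare (fun s => s.F) k 1 (fun _ => r.curvature) ![w] *
            latticeSchwinger r.ρ bare (fun s => s.F) k 1 (fun _ => r.curvature) ![thetaTest 4 w]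
      let T₂ : 𝓢(EuclideanSpace ℝ (Fin 4), ℝ) → 𝓢(EuclideanSpace ℝ (Fin 4), ℝ) → ℕ → ℝ := fun v w k =>
        latticeSchwinger r.ρ bare (fun s => s.F) k (1 + 1) (fun _ => r.curvature) ![v, w] -
          latticeSchwinger r.ρ bare (fun s => s.F) k 1 (fun _ => r.curvature) ![v] *
            latticeSchwinger r.ρ bare (fun s => s.F) k 1 (fun _ => r.curvature) ![w]
      sch.HasWeakCouplingLimit ∧
      (∃ N : ℕ, 1 ≤ N ∧ ∀ᶠ k in Filter.atTop, (sch.a k)⁻¹ ≤ (sch.a k * (sch.L k : ℝ)) ^ N) ∧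
      tsupport u ⊆ {y : EuclideanSpace ℝ (Fin 4) | y 0 < 0} ∧
      (∀ᶠ k in Filter.atTop, (sch.a k) ^ p ≤ T u k ∧ T u k ≤ M * T (timeShiftTest 4 (-1) u) k) ∧
      ∀ (s : ℕ) (B : ℝ), ∃ᶠ k in Filter.atTop, ∃ v w : 𝓢(EuclideanSpace ℝ (Fin 4), ℝ),
        Disjoint (tsupport v) (tsupport w) ∧ schwartzNorm s (ofRealTest v) ≤ 1 ∧
          schwartzNorm s (ofRealTest w) ≤ 1 ∧ B * T u k < |T₂ v w k|) →
      ¬ Summit.QuantumFields.YangMills.Theses.ScalingWindowSplit.SelfNormalisedMomentBoundsR := by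
  rintro ⟨G, _, _, _, _, _, _, r, sch, u, p, M, hw, hpv, hu, hfw, hfail⟩ hU
  obtain ⟨s, B, hB0, hB⟩ := twoPointEnvelope_of_selfNormalisedMomentBoundsR hU r sch u p M hw hpv hu hfw
  obtain ⟨k, ⟨v, w, hdisj, hv, hw', hlt⟩, hTpos, henv⟩ := ((hfail s (4 * B)).and_eventually hB).exists
  have h := henv v w hdisj
  have hle : B * (schwartzNorm s (ofRealTest v) + 1) * (schwartzNorm s (ofRealTest w) + 1) ≤ 4 * B := by
    have h1 : schwartzNorm s (ofRealTest v) + 1 ≤ 2 := by linarith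
    have h2 : schwartzNorm s (ofRealTest w) + 1 ≤ 2 := by linarith
    have h1' : 0 ≤ schwartzNorm s (ofRealTest v) + 1 := by linarith [schwartzNorm_nonneg s (ofRealTest v)]
    have h2' : 0 ≤ schwartzNorm s (ofRealTest w) + 1 := by linarith [schwartzNorm_nonneg s (ofRealTest w)]
    calc B * (schwartzNorm s (ofRealTest v) + 1) * (schwartzNorm s (ofRealTest w) + 1)
        ≤ B * 2 * 2 := by
          apply mul_le_mul (mul_le_mul_of_nonneg_left h1 hB0) h2 h2' (by positivity)
      _ = 4 * B := by ring
  have : |_| ≤ 4 * B * _ := h.trans (mul_le_mul_of_nonneg_right hle hTpos.le)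
  exact absurd hlt (not_lt.2 this)

end Summit.QuantumFields.YangMills.Theorems.SelfNormalisedMomentBoundsR.Negative

end
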